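import Literature.MathematicalPhysics.QuantumFieldTheory.ConformalBootstrap3D.PointKernelLowerV3

/-!
# Lower-box certificate theorem, v3 head cells, with a SEMANTIC termwise region

`PCert.boxExcluded_of_kernelV3` (v3 head cells + (O1) pieces + (T) `tOK` + (M) corner-box tables)
with the (M) corner tables replaced by the termwise hypothesis itself:
`hM : ∀ j E, E₀ ≤ E → E < E_T → j + τ ≤ E → ∀ p ∈ box, 0 ≤ φ_p(crossF 𝓜_{E,j})`.
The instance then proves `hM` by whatever mixture it has — first-order corner rows
(`ruleM_of_cornerTables_pieces`) where they converge, and kernel mono cells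
(`PKTM.monoPos_of_cellPass`, Taylor models in `E`) where the monomial functional has deep
near-zeros (certificate K34L515: corner boxes do not converge beyond `E ≈ 35`).
[cite: HogervorstRychkov2013, §3 eq. (3.6)]; no new analysis.
-/

noncomputable section

namespace Literature.MathematicalPhysics.QuantumFieldTheory.ConformalBootstrap3D

open Real Finset Set

namespace PointKernel

namespace PCert

variable {c : PCert}

/-- **The lower-box certificate theorem of the kernel, v3 head cells, semantic (M).** As
`boxExcluded_of_kernelV3` but the termwise region `E ∈ [E₀, E_T)` is a hypothesis `hM` on the box
instead of corner-box tables. [cite: HogervorstRychkov2013, §3 eq. (3.6)] -/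
theorem boxExcluded_of_kernelV3M (hc : c.checkNodes = true)
    (KI : ℕ) (σI : ℕ → ℚ) (hKI : 0 < KI) (hσI0 : σI 0 = c.slo) (hσIK : σI KI = c.shi)
    (hIrow : ∀ i < KI, ∀ s ∈ Icc ((σI i : ℚ) : ℝ) ((σI (i + 1) : ℚ) : ℝ),
      0 < pointFunctional c.wR c.zR c.zbR (crossF s (-1) (fun _ _ => (1 : ℝ))))
    (qd qr : List ℚ) (ET : ℕ) (hT : c.tOK qd qr ET = true)
    (εlo εhi E0 τ : ℚ) (L : ℕ) (hτ1 : τ ≤ 1) (hτ0 : τ ≤ E0) (hL : E0 ≤ (L : ℚ) + 1)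
    (hM : ∀ (j : ℕ) (E : ℝ), ((E0 : ℚ) : ℝ) ≤ E → E < ((ET : ℕ) : ℝ) → (j : ℝ) + ((τ : ℚ) : ℝ) ≤ E →
      ∀ p ∈ QBoxL c.slo c.shi εlo εhi,
        0 ≤ pointFunctional c.wR c.zR c.zbR (crossF p.1 (-1) (zMono E j)))
    (t : ℕ → ℕ → ℝ) (K : ℕ → ℕ) (tε : ℕ → ℝ) (Kε : ℕ)
    (htε : tε 0 = ((εlo : ℚ) : ℝ) ∧ tε Kε = ((εhi : ℚ) : ℝ))
    (ht0 : t 0 0 ≤ 3 ∧ t 0 (K 0) = ((E0 : ℚ) : ℝ))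
    (htℓ : ∀ ℓ, Even ℓ → ℓ ≠ 0 → ℓ < L → t ℓ 0 = (ℓ : ℝ) + 1 ∧ t ℓ (K ℓ) = ((E0 : ℚ) : ℝ))
    (hcellε : ∀ k < Kε, c.V3Block ((E0 : ℚ) : ℝ) ((τ : ℚ) : ℝ) (tε k) (tε (k + 1)) 0)
    (hcell : ∀ ℓ, (ℓ = 0 ∨ (Even ℓ ∧ ℓ < L)) → ∀ k < K ℓ,
      c.V3Block ((E0 : ℚ) : ℝ) ((τ : ℚ) : ℝ) (t ℓ k) (t ℓ (k + 1)) ℓ) :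
    BoxExcluded (QBoxL c.slo c.shi εlo εhi) := by
  obtain ⟨hqd, hqr, hdomd, hdomr, hB⟩ := t_hyps hc qd qr ET hT
  have hz := zR_mem hc
  have hzb := zbR_mem hc
  have hord : ∀ k : Fin c.N, c.zbR k ≤ c.zR k := by
    intro k
    have hn := checkNode_of_checkNodes hc k.2
    simpa [zR, zbR] using (show ((c.zb k : ℚ) : ℝ) ≤ ((c.z k : ℚ) : ℝ) by exact_mod_cast zb_le_z hn)
  have hapex : 0 ≤ c.wR ⟨c.apex, apex_lt hc⟩ := by
    simpa [wR] using (show ((0 : ℚ) : ℝ) ≤ ((c.w c.apex : ℚ) : ℝ) by exact_mod_cast w_apex_nonneg hc)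
  have hQ1 : ∀ p ∈ QBoxL c.slo c.shi εlo εhi, ((c.slo : ℚ) : ℝ) ≤ p.1 ∧ p.1 ≤ ((c.shi : ℚ) : ℝ) :=
    fun p hp => hp.1
  -- (O1) from the identity pieces
  have hI : ∀ p ∈ QBoxL c.slo c.shi εlo εhi,
      0 < pointFunctional c.wR c.zR c.zbR (crossF p.1 (-1) (fun _ _ => (1 : ℝ))) := by
    intro p hp
    obtain ⟨i, hi, hs⟩ := exists_piece_Icc (fun i => ((σI i : ℚ) : ℝ)) KI hKI p.1
      ⟨by simp only [hσI0]; exact hp.1.1, by simp only [hσIK]; exact hp.1.2⟩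
    exact hIrow i hi p.1 hs
  -- the tail terms on the whole twist domain: (M) below `E_T`, (T) from `E_T` on
  have htail := tail_nonneg_of_pointRules_twist c.wR c.zR c.zbR hz hzb hord ⟨c.apex, apex_lt hc⟩ hapex
    (c.qR qd) (c.qR qr) hqd hqr hdomd hdomr hQ1 hM hB
  exact boxExcluded_of_pointCells hz hzb hord ⟨c.apex, apex_lt hc⟩ hapex (c.qR qd) (c.qR qr) hqd hqr
    hdomd hdomr t K tε Kε (fun p hp => ⟨hp.1, Or.inl hp.2⟩) L (by exact_mod_cast hL)
    (by exact_mod_cast hτ1) (by exact_mod_cast hτ0) hI htε ht0 htℓ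
    (fun k hk p hp Δ hΔ => hcellε k hk _ hQ1 htail p hp Δ hΔ)
    (fun ℓ hℓ k hk p hp Δ hΔ => hcell ℓ hℓ k hk _ hQ1 htail p hp Δ hΔ) hM hB

/-- Gluing of the termwise hypothesis over two `E`-ranges `[E₀, E₁)` and `[E₁, E_T)` (corner rows
below, kernel mono cells above, say). [folklore] -/
theorem hM_of_two_ranges {Q : Set (ℝ × ℝ)} {E₀ E₁ ET τ : ℝ}
    (h₁ : ∀ (j : ℕ) (E : ℝ), E₀ ≤ E → E < E₁ → (j : ℝ) + τ ≤ E → ∀ p ∈ Q,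
      0 ≤ pointFunctional c.wR c.zR c.zbR (crossF p.1 (-1) (zMono E j)))
    (h₂ : ∀ (j : ℕ) (E : ℝ), E₁ ≤ E → E < ET → (j : ℝ) + τ ≤ E → ∀ p ∈ Q,
      0 ≤ pointFunctional c.wR c.zR c.zbR (crossF p.1 (-1) (zMono E j))) :
    ∀ (j : ℕ) (E : ℝ), E₀ ≤ E → E < ET → (j : ℝ) + τ ≤ E → ∀ p ∈ Q,
      0 ≤ pointFunctional c.wR c.zR c.zbR (crossF p.1 (-1) (zMono E j)) := by
  intro j E hE0 hET hjτ p hp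
  by_cases h : E < E₁
  · exact h₁ j E hE0 h hjτ p hp
  · exact h₂ j E (not_lt.1 h) hET hjτ p hp

/-- One `j`-row of the termwise hypothesis from cells: if `[E_lo, E_hi]` is covered by cells
`[u k, u (k+1)]`, `k < K`, `u 0 ≤ E_lo`, `E_hi ≤ u K`, `u` monotone, each carrying the mono
positivity statement on `s ∈ [s_lo, s_hi]`, then the row statement holds on `[E_lo, E_hi]`.
[folklore] -/
theorem monoRow_of_cells {slo shi : ℝ} {j : ℕ} (u : ℕ → ℝ) (K : ℕ) (hK : 0 < K)
    (hcells : ∀ k < K, ∀ s ∈ Icc slo shi, ∀ E ∈ Icc (u k) (u (k + 1)),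
      0 ≤ pointFunctional c.wR c.zR c.zbR (crossF s (-1) (zMono E j))) :
    ∀ s ∈ Icc slo shi, ∀ E ∈ Icc (u 0) (u K),
      0 ≤ pointFunctional c.wR c.zR c.zbR (crossF s (-1) (zMono E j)) := by
  intro s hs E hE
  obtain ⟨k, hk, hEk⟩ := exists_piece_Icc u K hK E hE
  exact hcells k hk s hs E hEk

end PCert

end PointKernel

end Literature.MathematicalPhysics.QuantumFieldTheory.ConformalBootstrap3D
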